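import Summits.Ventures.Crystal3D.Theorems.StickyWulffConstantGenericWallFloorExitTrichotomy
import Summits.Ventures.Crystal3D.Theorems.StickyWulffConstantGenericWallFloorCredits
import HarnessLib

/-!
# Exits pay: the non-twin-capped exits of a grain are controlled by the unsaturated balls near them

HONEST FRAMING. Part of the venture `Summits/Ventures/Crystal3D` (cell `crystal3d-full`), helper for the
crux `GenericWallFloor` (stmt-Ventures-19480) of `route-Ventures-StickyWulffConstant`, REGISTERED line
`WallLedgerG` (planner cf-p1 gen 16), stub `stub_twoSlabAdhesion : TwoSlabAdhesion` (THE CRUX of the line).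
Brick of the general-filling architecture (memo GENERAL-FILLING-ARCH on the item): the SINK bound for the
exits that are not twin caps.  Cell-free (any finite `1`-separated configuration).  Rung credit only; F-C1 not
moved.

For a grain frame `A` and a slot `u`, an EXIT is a ball `e ∈ X` with `e − A u ∈ X` carrying its full shell and
some slot of `e` empty (`card_exits_ge` counts them in the wall cell: at least the line flux); it is TWIN-CAPPED
when the conclusion of the exit lemma holds at `e` (a `{111}` normal `n`, near nine slots occupied, far three
empty with mirrors occupied).

**Theorem (`card_exits_le`).**  Under GAP(`δ`) ∧ CLASSIFICATION(`δ`):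
`#exits ≤ #twin-capped exits + 1885 · #{unsaturated balls within contact distance 3 of a non-capped exit}`.
Each non-capped exit has, by `exit_trichotomy`, an unsaturated ball within contact distance `3`; a ball has
at most `1885 = 1 + 12 + 12² + 12³` balls within contact distance `3` (`card_withinThree_le`, kissing bound
`card_filter_dist_eq_one_le_twelve`), so the assignment has fibres of size `≤ 1885`.

WHAT THIS IS NOT: not the stub — the twin-capped exits are NOT paid here (they are followed through the cap by
the monotone-lines bookkeeping, not yet written); F-C1 not moved.
-/

noncomputable section

namespace Summit.Ventures.Crystal3D.Theorems

open Summit.Ventures.Crystal3D Finset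
open Literature.MathematicalPhysics.StatisticalMechanics (fccStacking)
open scoped InnerProductSpace

variable {X : Finset (EuclideanSpace ℝ (Fin 3))}

/-! ### Balls within contact distance three -/

open scoped Classical in
/-- One contact step from a set `S`: at most `12 · #S` balls (kissing bound). -/
theorem card_biUnion_contacts_le (hX : ∀ p ∈ X, ∀ q ∈ X, p ≠ q → 1 ≤ dist p q)
    (S : Finset (EuclideanSpace ℝ (Fin 3))) :
    (S.biUnion fun z => X.filter fun q => dist z q = 1).card ≤ 12 * S.card := by
  calc (S.biUnion fun z => X.filter fun q => dist z q = 1).card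
      ≤ ∑ z ∈ S, (X.filter fun q => dist z q = 1).card := card_biUnion_le
    _ ≤ ∑ _z ∈ S, 12 := sum_le_sum fun z _ => card_filter_dist_eq_one_le_twelve X hX z
    _ = 12 * S.card := by rw [sum_const, smul_eq_mul, mul_comm]

open scoped Classical in
/-- **At most `1885` balls within contact distance three** of a given ball `y` (in the orientation used by
`exit_trichotomy`: paths from `e` to `y`). -/
theorem card_withinThree_le (hX : ∀ p ∈ X, ∀ q ∈ X, p ≠ q → 1 ≤ dist p q) (y : EuclideanSpace ℝ (Fin 3)) :
    (X.filter fun e => y = e ∨ dist e y = 1 ∨ (∃ z ∈ X, dist e z = 1 ∧ dist z y = 1) ∨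
        ∃ z ∈ X, ∃ z' ∈ X, dist e z = 1 ∧ dist z z' = 1 ∧ dist z' y = 1).card ≤ 1885 := by
  set N : Finset (EuclideanSpace ℝ (Fin 3)) → Finset (EuclideanSpace ℝ (Fin 3)) :=
    fun S => S.biUnion fun z => X.filter fun q => dist z q = 1 with hN
  have hN1 : (N {y}).card ≤ 12 := by
    have := card_biUnion_contacts_le hX ({y} : Finset _); simpa [hN] using this
  have hN2 : (N (N {y})).card ≤ 144 := (card_biUnion_contacts_le hX _).trans (by omega)
  have hN3 : (N (N (N {y}))).card ≤ 1728 := (card_biUnion_contacts_le hX _).trans (by omega)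
  have hsub : (X.filter fun e => y = e ∨ dist e y = 1 ∨ (∃ z ∈ X, dist e z = 1 ∧ dist z y = 1) ∨
      ∃ z ∈ X, ∃ z' ∈ X, dist e z = 1 ∧ dist z z' = 1 ∧ dist z' y = 1) ⊆
      {y} ∪ N {y} ∪ N (N {y}) ∪ N (N (N {y})) := by
    intro e he
    rw [mem_filter] at he
    obtain ⟨heX, h⟩ := he
    have mem1 : ∀ {a b : EuclideanSpace ℝ (Fin 3)} {S : Finset _}, a ∈ S → b ∈ X → dist b a = 1 → b ∈ N S := by
      intro a b S ha hb hd
      rw [hN, mem_biUnion]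
      exact ⟨a, ha, mem_filter.2 ⟨hb, by rw [dist_comm]; exact hd⟩⟩
    rcases h with rfl | h | ⟨z, hz, hez, hzy⟩ | ⟨z, hz, z', hz', hez, hzz', hz'y⟩
    · simp
    · exact mem_union_left _ (mem_union_left _ (mem_union_right _ (mem1 (mem_singleton_self y) heX h)))
    · exact mem_union_left _ (mem_union_right _ (mem1 (mem1 (mem_singleton_self y) hz hzy) heX hez))
    · exact mem_union_right _ (mem1 (mem1 (mem1 (mem_singleton_self y) hz' hz'y) hz hzz') heX hez)
  calc _ ≤ ({y} ∪ N {y} ∪ N (N {y}) ∪ N (N (N {y}))).card := card_le_card hsub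
    _ ≤ (({y} ∪ N {y} ∪ N (N {y})).card) + (N (N (N {y}))).card := card_union_le _ _
    _ ≤ (({y} ∪ N {y}).card + (N (N {y})).card) + (N (N (N {y}))).card := by
        gcongr; exact card_union_le _ _
    _ ≤ ((({y} : Finset _).card + (N {y}).card) + (N (N {y})).card) + (N (N (N {y}))).card := by
        gcongr; exact card_union_le _ _
    _ ≤ 1 + 12 + 144 + 1728 := by rw [card_singleton]; omega
    _ = 1885 := by norm_num

/-! ### Exits pay -/

open scoped Classical in
/-- **Non-capped exits are paid by nearby unsaturated balls** (see the module docstring):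
`#exits ≤ #twin-capped exits + 1885 · #{unsaturated balls within contact distance 3 of a non-capped exit}`. -/
theorem card_exits_le {δ : ℝ} (hg : KissingGap δ) (hc : KissingClassification δ)
    (hX : ∀ p ∈ X, ∀ q ∈ X, p ≠ q → 1 ≤ dist p q)
    (A : EuclideanSpace ℝ (Fin 3) ≃ₗᵢ[ℝ] EuclideanSpace ℝ (Fin 3)) {u : EuclideanSpace ℝ (Fin 3)}
    (hu : u ∈ fccSlots) :
    (X.filter fun e => e - A u ∈ X ∧ (∀ w ∈ fccSlots, e - A u + A w ∈ X) ∧ ∃ v ∈ fccSlots, e + A v ∉ X).card ≤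
      ((X.filter fun e => e - A u ∈ X ∧ (∀ w ∈ fccSlots, e - A u + A w ∈ X) ∧ ∃ v ∈ fccSlots, e + A v ∉ X).filter
        fun e => ∃ n : EuclideanSpace ℝ (Fin 3), ‖n‖ = 1 ∧
          (∀ w ∈ fccSlots, ⟪A w, n⟫_ℝ = 0 ∨ ⟪A w, n⟫_ℝ = Real.sqrt (2 / 3) ∨ ⟪A w, n⟫_ℝ = -Real.sqrt (2 / 3)) ∧
          ⟪A u, n⟫_ℝ = Real.sqrt (2 / 3) ∧
          (∀ w ∈ fccSlots, ⟪A w, n⟫_ℝ ≤ 0 → e + A w ∈ X) ∧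
          (∀ w ∈ fccSlots, 0 < ⟪A w, n⟫_ℝ → e + A w ∉ X ∧ e - A w + (2 * ⟪A w, n⟫_ℝ) • n ∈ X)).card +
      1885 * (X.filter fun y => (X.filter fun q => dist y q = 1).card ≠ 12 ∧
        ∃ e ∈ X, (e - A u ∈ X ∧ (∀ w ∈ fccSlots, e - A u + A w ∈ X) ∧ ∃ v ∈ fccSlots, e + A v ∉ X) ∧
          (y = e ∨ dist e y = 1 ∨ (∃ z ∈ X, dist e z = 1 ∧ dist z y = 1) ∨
            ∃ z ∈ X, ∃ z' ∈ X, dist e z = 1 ∧ dist z z' = 1 ∧ dist z' y = 1)).card := by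
  -- names
  set EX := X.filter fun e => e - A u ∈ X ∧ (∀ w ∈ fccSlots, e - A u + A w ∈ X) ∧
    ∃ v ∈ fccSlots, e + A v ∉ X with hEX
  set capped : EuclideanSpace ℝ (Fin 3) → Prop := fun e => ∃ n : EuclideanSpace ℝ (Fin 3), ‖n‖ = 1 ∧
    (∀ w ∈ fccSlots, ⟪A w, n⟫_ℝ = 0 ∨ ⟪A w, n⟫_ℝ = Real.sqrt (2 / 3) ∨ ⟪A w, n⟫_ℝ = -Real.sqrt (2 / 3)) ∧
    ⟪A u, n⟫_ℝ = Real.sqrt (2 / 3) ∧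
    (∀ w ∈ fccSlots, ⟪A w, n⟫_ℝ ≤ 0 → e + A w ∈ X) ∧
    (∀ w ∈ fccSlots, 0 < ⟪A w, n⟫_ℝ → e + A w ∉ X ∧ e - A w + (2 * ⟪A w, n⟫_ℝ) • n ∈ X) with hcapped
  set W3 : EuclideanSpace ℝ (Fin 3) → EuclideanSpace ℝ (Fin 3) → Prop := fun e y =>
    y = e ∨ dist e y = 1 ∨ (∃ z ∈ X, dist e z = 1 ∧ dist z y = 1) ∨
      ∃ z ∈ X, ∃ z' ∈ X, dist e z = 1 ∧ dist z z' = 1 ∧ dist z' y = 1 with hW3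
  set U := X.filter fun y => (X.filter fun q => dist y q = 1).card ≠ 12 ∧
    ∃ e ∈ X, (e - A u ∈ X ∧ (∀ w ∈ fccSlots, e - A u + A w ∈ X) ∧ ∃ v ∈ fccSlots, e + A v ∉ X) ∧ W3 e y
    with hU
  -- every non-capped exit has an unsaturated ball within three
  have key : ∀ e ∈ EX.filter (fun e => ¬ capped e), ∃ y ∈ U, W3 e y := by
    intro e he
    rw [mem_filter] at he
    obtain ⟨heEX, hnc⟩ := he
    have heEX' := heEX
    rw [hEX, mem_filter] at heEX'
    obtain ⟨heX, hdX, hfull, v, hv, hvX⟩ := heEX'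
    have hde : e - A u + A u = e := sub_add_cancel e (A u)
    rcases exit_trichotomy hg hc hX A hdX hfull hu ⟨v, hv, by rw [hde]; exact hvX⟩ with
      ⟨y, hy, hw, hne⟩ | hcap
    · rw [hde] at hw
      refine ⟨y, ?_, hw⟩
      rw [hU, mem_filter]
      exact ⟨hy, hne, e, heX, ⟨hdX, hfull, v, hv, hvX⟩, hw⟩
    · exact absurd (by simpa only [hcapped, hde] using hcap) hnc
  choose! f hf using key
  -- fibres of `f` have at most 1885 elements
  have hfib : ∀ y ∈ (EX.filter fun e => ¬ capped e).image f,
      ((EX.filter fun e => ¬ capped e).filter fun e => f e = y).card ≤ 1885 := by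
    intro y _
    refine le_trans (card_le_card ?_) (card_withinThree_le hX y)
    intro e he
    rw [mem_filter] at he
    obtain ⟨he, hfe⟩ := he
    have hw := (hf e he).2
    rw [hfe] at hw
    rw [mem_filter]
    exact ⟨(mem_filter.1 (mem_filter.1 he).1).1, hw⟩
  have himg : (EX.filter fun e => ¬ capped e).image f ⊆ U := by
    intro y hy
    obtain ⟨e, he, rfl⟩ := mem_image.1 hy
    exact (hf e he).1
  have h1 : (EX.filter fun e => ¬ capped e).card ≤ 1885 * U.card :=
    calc (EX.filter fun e => ¬ capped e).card
        ≤ 1885 * ((EX.filter fun e => ¬ capped e).image f).card := card_le_mul_card_image _ _ hfib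
      _ ≤ 1885 * U.card := Nat.mul_le_mul_left _ (card_le_card himg)
  have h2 : EX.card = (EX.filter capped).card + (EX.filter fun e => ¬ capped e).card :=
    (card_filter_add_card_filter_not (s := EX) capped).symm
  show EX.card ≤ (EX.filter capped).card + 1885 * U.card
  omega

end Summit.Ventures.Crystal3D.Theorems

end
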